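import Mathlib
import HarnessLib
import Literature.Analysis.FluidPDE.CKNTheoremB
import Literature.Analysis.FluidPDE.LocalTypeI

/-!
# Route `AxisTwistDoor`, crux `AveragedConeLiouville` (stmt-NavierStokesRegularity-26889) — toward replacing the
# Lei–Ren input (programme R2), piece S2: CKN's Theorem B ON THE BLOW-UP LID, from Proposition 2 on the lid

After 2026-08-28 the crux is conditional on ONE literature fact, Lei–Ren's quantitative regular shells
(`LeiRen2024_quantitative_regular_shells_cyl`, consumed as `ShellFact`).  Programme R2 (LEAD census CENSUS-26889-g2.md)
replaces it by compactness (`SuitableCompactness_holds`) + partial regularity of the limit + persistence of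
singularities (`PersistenceOfSingularities_holds`).  The partial regularity of the limit is needed UP TO THE APEX TIME:
in the interior it is the tree's `ckn_partial_regularity_holds` (open sets, centred cylinders); on the LID `t = T` of a
backward cylinder `Q_R(T, x₀)` one needs the backward-singular points `(T, x)` (`IsBackwardSingularPoint`: `u`
unbounded on every `Q_r(T, x)`) to form a `𝒫¹`-null set.  Caffarelli–Kohn–Nirenberg's §6 covering argument gives this
VERBATIM once Proposition 2 is available at lid points in backward form — piece S1 of R2, taken here as a HYPOTHESIS
on the given `u`:

* `frequently_lt_of_isBackwardSingularPoint` — contrapositive of the lid Proposition 2: at a backward-singular lid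
  point, `ε r < ∫∫_{Q_r(T,x)} |∇u|²` for arbitrarily small `r`.
* `isParabolicNull_lidSingularSet` — **Theorem B on the lid**: if `∇u ∈ L²(Q_R(T, x₀))` and every lid point
  `(T, x)`, `x ∈ B(x₀, R)`, with `limsup_{r→0} r⁻¹∫∫_{Q_r(T,x)}|∇u|² ≤ ε` is backward-regular, then for `R' < R` the
  set `{(T, x) : x ∈ B̄(x₀, R'), (T, x) backward-singular}` is `𝒫¹`-null.  Proof: the tree's Vitali estimate
  `parabolicHausdorff_one_le_of_frequently` with `F = |∇u|² 𝟙_{Q_R(T,x₀)}` (the centred cylinders `Q*_r(T,x)` meet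
  the support of `F` only in the backward cylinders `Q_r(T,x)`), inside the open sets
  `(T − δ², T + δ²) × B(x₀, R″)`, whose `F`-mass `≤ ∫∫_{(T−δ²,T)×B(x₀,R)} |∇u|² → 0` as `δ → 0`.

No suitability is used in this file (only the integrability of the gradient and the lid ε-regularity hypothesis);
S1 (the lid Proposition 2 = CKN's decay scheme at downward-shifted centres + the quantitative one-scale criterion
`RRS2016.theorem15_3_holds`, whose open backward cylinders are admissible at lid points) is the next piece.

Seat ns-atd-p1 (LEAD g2).  WHAT THIS IS NOT: not a statement about Navier–Stokes regularity; a covering lemma serving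
a STAGED door route; the crux stays conditional on Lei–Ren 2024 until R1 or R2 completes.  Lands `--supports` the crux
item as a helper.
-/

noncomputable section

set_option linter.dupNamespace false

namespace Summit.NavierStokesRegularity.NavierStokesRegularity.Theorems.AveragedConeLiouville.LidTheoremB

open scoped ENNReal NNReal Topology
open Set Function MeasureTheory Metric Filter
open Literature.Analysis.FluidPDE

/-! ### The lid Proposition 2, contrapositive -/

/-- At a backward-singular lid point where the lid ε-regularity criterion is available, the dissipation density
exceeds `ε` at arbitrarily small scales: `∃ᶠ r → 0⁺, ε·r < ∫∫_{Q_r(T,x)} |G|²`. -/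
theorem frequently_lt_of_isBackwardSingularPoint
    {u : ℝ → EuclideanSpace ℝ (Fin 3) → EuclideanSpace ℝ (Fin 3)}
    {G : ℝ → EuclideanSpace ℝ (Fin 3) → EuclideanSpace ℝ (Fin 3) →L[ℝ] EuclideanSpace ℝ (Fin 3)}
    {ε : ℝ} {w : ℝ × EuclideanSpace ℝ (Fin 3)}
    (hreg : limsup (fun r : ℝ => cknE r w G) (𝓝[>] (0 : ℝ)) ≤ ENNReal.ofReal ε → ¬ IsBackwardSingularPoint u w)
    (hsing : IsBackwardSingularPoint u w) :
    ∃ᶠ r in 𝓝[>] (0 : ℝ), ENNReal.ofReal ε * ENNReal.ofReal r <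
      ∫⁻ q in parabolicCylinder r w, ENNReal.ofReal (frobeniusNormSq (G q.1 q.2)) := by
  by_contra hcon
  refine hreg ?_ hsing
  rw [Filter.not_frequently] at hcon
  refine Filter.limsup_le_of_le (by isBoundedDefault) ?_
  filter_upwards [hcon, self_mem_nhdsWithin] with r hr hr0
  rw [mem_Ioi] at hr0
  have hr0' : ENNReal.ofReal r ≠ 0 := (ENNReal.ofReal_pos.2 hr0).ne'
  unfold cknE
  calc (ENNReal.ofReal r)⁻¹ * ∫⁻ q in parabolicCylinder r w, ENNReal.ofReal (frobeniusNormSq (G q.1 q.2))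
      ≤ (ENNReal.ofReal r)⁻¹ * (ENNReal.ofReal ε * ENNReal.ofReal r) := mul_le_mul' le_rfl (not_lt.1 hr)
    _ = ENNReal.ofReal ε := by
        rw [mul_comm (ENNReal.ofReal ε), ← mul_assoc, ENNReal.inv_mul_cancel hr0' ENNReal.ofReal_ne_top, one_mul]

/-! ### Geometry: backward cylinders about lid points -/

/-- A small backward cylinder about a lid point `(T, x)`, `x ∈ B(x₀, R″)`, `r ≤ R − R″`, lies in `Q_R(T, x₀)`. -/
theorem parabolicCylinder_lid_subset {T R R'' r : ℝ} {x₀ x : EuclideanSpace ℝ (Fin 3)}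
    (hx : x ∈ ball x₀ R'') (hr : 0 < r) (hrR : r ≤ R - R'') :
    parabolicCylinder r ((T, x) : ℝ × EuclideanSpace ℝ (Fin 3)) ⊆ parabolicCylinder R (T, x₀) := by
  rintro ⟨t, y⟩ hq
  rw [mem_parabolicCylinder] at hq ⊢
  obtain ⟨⟨ht1, ht2⟩, hy⟩ := hq
  simp only at ht1 ht2 hy ⊢
  have hrR' : r ≤ R := by linarith [(le_of_lt (lt_of_le_of_lt dist_nonneg (mem_ball.1 hx)) : (0:ℝ) ≤ R'')]
  refine ⟨⟨by nlinarith, ht2⟩, ?_⟩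
  calc dist y x₀ ≤ dist y x + dist x x₀ := dist_triangle _ _ _
    _ < r + R'' := add_lt_add hy (mem_ball.1 hx)
    _ ≤ R := by linarith

/-- The part of a centred cylinder about a lid point `(T, x)` that lies in `Q_R(T, x₀)` is contained in the backward
cylinder `Q_r(T, x)` (times `≥ T` are not in `Q_R(T, x₀)`). -/
theorem parabolicCylinderCentered_inter_subset {T R r : ℝ} {x₀ x : EuclideanSpace ℝ (Fin 3)} :
    parabolicCylinderCentered r ((T, x) : ℝ × EuclideanSpace ℝ (Fin 3)) ∩ parabolicCylinder R (T, x₀) ⊆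
      parabolicCylinder r (T, x) := by
  rintro ⟨t, y⟩ ⟨h1, h2⟩
  rw [mem_parabolicCylinder] at h2 ⊢
  obtain ⟨⟨ht1, -⟩, hy⟩ := h1
  exact ⟨⟨ht1, h2.1.2⟩, hy⟩

/-! ### Theorem B on the lid -/

/-- **Caffarelli–Kohn–Nirenberg's Theorem B on the blow-up lid, from Proposition 2 on the lid.**  Let `G`
(standing for `∇u`) satisfy `∫∫_{Q_R(T,x₀)} |G|² < ∞`, and suppose the lid ε-regularity criterion with constant
`ε > 0`: every `x ∈ B(x₀, R)` with `limsup_{r→0⁺} r⁻¹ ∫∫_{Q_r(T,x)} |G|² ≤ ε` is such that `(T, x)` is not a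
backward-singular point of `u`.  Then for every `R' < R` the set of backward-singular lid points over `B̄(x₀, R')`
has one-dimensional parabolic Hausdorff measure zero. [cite: CaffarelliKohnNirenberg1982, §6 Theorem B (covering
argument); RobinsonRodrigoSadowski2016, Thm. 16.2] -/
theorem isParabolicNull_lidSingularSet
    {u : ℝ → EuclideanSpace ℝ (Fin 3) → EuclideanSpace ℝ (Fin 3)}
    {G : ℝ → EuclideanSpace ℝ (Fin 3) → EuclideanSpace ℝ (Fin 3) →L[ℝ] EuclideanSpace ℝ (Fin 3)}
    {T R R' ε : ℝ} {x₀ : EuclideanSpace ℝ (Fin 3)} (hR' : R' < R) (hε : 0 < ε)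
    (hGint : ∫⁻ w in parabolicCylinder R ((T, x₀) : ℝ × EuclideanSpace ℝ (Fin 3)),
      ENNReal.ofReal (frobeniusNormSq (G w.1 w.2)) < ∞)
    (hreg : ∀ x ∈ ball x₀ R, limsup (fun r : ℝ => cknE r ((T, x) : ℝ × EuclideanSpace ℝ (Fin 3)) G)
      (𝓝[>] (0 : ℝ)) ≤ ENNReal.ofReal ε → ¬ IsBackwardSingularPoint u (T, x)) :
    IsParabolicNull 1 {w : ℝ × EuclideanSpace ℝ (Fin 3) |
      w.1 = T ∧ w.2 ∈ closedBall x₀ R' ∧ IsBackwardSingularPoint u w} := by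
  set Y : Set (ℝ × EuclideanSpace ℝ (Fin 3)) :=
    {w | w.1 = T ∧ w.2 ∈ closedBall x₀ R' ∧ IsBackwardSingularPoint u w} with hY
  set cyl : Set (ℝ × EuclideanSpace ℝ (Fin 3)) := parabolicCylinder R (T, x₀) with hcyl
  set F : ℝ × EuclideanSpace ℝ (Fin 3) → ℝ≥0∞ :=
    cyl.indicator (fun w => ENNReal.ofReal (frobeniusNormSq (G w.1 w.2))) with hF
  have hcylm : MeasurableSet cyl := (isOpen_parabolicCylinder R _).measurableSet
  -- an intermediate radius
  set R'' : ℝ := (R + R') / 2 with hR''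
  have hR''1 : R' < R'' := by rw [hR'']; linarith
  have hR''2 : R'' < R := by rw [hR'']; linarith
  -- the covering estimate inside `V_δ = (T − δ², T + δ²) × B(x₀, R″)`, for every `δ > 0`
  have hest : ∀ δ : ℝ, 0 < δ → parabolicHausdorff 1 Y ≤ 5 * (ENNReal.ofReal ε)⁻¹ *
      ∫⁻ w in (Ioo (T - δ ^ 2) T ×ˢ ball x₀ R) ∩ cyl, ENNReal.ofReal (frobeniusNormSq (G w.1 w.2)) := by
    intro δ hδ
    set V : Set (ℝ × EuclideanSpace ℝ (Fin 3)) := Ioo (T - δ ^ 2) (T + δ ^ 2) ×ˢ ball x₀ R'' with hV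
    have hVo : IsOpen V := isOpen_Ioo.prod isOpen_ball
    have hYV : Y ⊆ V := by
      rintro ⟨t, y⟩ ⟨ht, hy, -⟩
      simp only at ht hy
      refine ⟨⟨by rw [ht]; nlinarith, by rw [ht]; nlinarith⟩, ?_⟩
      exact lt_of_le_of_lt (mem_closedBall.1 hy) hR''1
    -- every point of `Y` carries dissipation density `> ε` on small backward = centred-∩-support cylinders
    have hfreq : ∀ z ∈ Y, ∃ᶠ r in 𝓝[>] (0 : ℝ),
        ENNReal.ofReal ε * ENNReal.ofReal r < ∫⁻ w in parabolicCylinderCentered r z, F w := by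
      rintro ⟨t, y⟩ ⟨ht, hy, hsing⟩
      simp only at ht hy
      subst ht
      have hyR : y ∈ ball x₀ R := lt_of_le_of_lt (mem_closedBall.1 hy) hR'
      have hyR'' : y ∈ ball x₀ R'' := lt_of_le_of_lt (mem_closedBall.1 hy) hR''1
      have h1 := frequently_lt_of_isBackwardSingularPoint (hreg y hyR) hsing
      have hsmall : ∀ᶠ r in 𝓝[>] (0 : ℝ), 0 < r ∧ r ≤ R - R'' := by
        have : Ioo (0 : ℝ) (R - R'') ∈ 𝓝[>] (0 : ℝ) := Ioo_mem_nhdsGT (by linarith)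
        filter_upwards [this] with r hr
        exact ⟨hr.1, hr.2.le⟩
      refine (h1.and_eventually hsmall).mono ?_
      rintro r ⟨hr, hr0, hrR⟩
      refine lt_of_lt_of_le hr ?_
      -- `∫∫_{Q_r(T,y)} |G|² = ∫∫_{Q_r(T,y)} F ≤ ∫∫_{Q*_r(T,y)} F`
      have hsub : parabolicCylinder r ((t, y) : ℝ × EuclideanSpace ℝ (Fin 3)) ⊆ cyl :=
        parabolicCylinder_lid_subset hyR'' hr0 hrR
      calc ∫⁻ q in parabolicCylinder r (t, y), ENNReal.ofReal (frobeniusNormSq (G q.1 q.2))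
          = ∫⁻ q in parabolicCylinder r (t, y), F q := by
            refine setLIntegral_congr_fun (isOpen_parabolicCylinder r _).measurableSet ?_
            intro q hq
            rw [hF, indicator_of_mem (hsub hq)]
        _ ≤ ∫⁻ q in parabolicCylinderCentered r (t, y), F q :=
            lintegral_mono_set (fun q hq => by
              rw [mem_parabolicCylinder] at hq
              exact ⟨⟨hq.1.1, by have := hq.1.2; simp only at this ⊢; nlinarith⟩, hq.2⟩)
    have hmain := parabolicHausdorff_one_le_of_frequently (F := F) hVo hYV
      (l := ENNReal.ofReal ε) ((ENNReal.ofReal_pos.2 hε).ne') ENNReal.ofReal_ne_top hfreq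
    refine hmain.trans (mul_le_mul' le_rfl ?_)
    -- `∫∫_V F ≤ ∫∫_{(T−δ²,T)×B(x₀,R)} |G|²`
    calc ∫⁻ w in V, F w = ∫⁻ w in V ∩ cyl, ENNReal.ofReal (frobeniusNormSq (G w.1 w.2)) := by
          rw [hF, lintegral_indicator hcylm, Measure.restrict_restrict hcylm, inter_comm]
      _ ≤ ∫⁻ w in (Ioo (T - δ ^ 2) T ×ˢ ball x₀ R) ∩ cyl, ENNReal.ofReal (frobeniusNormSq (G w.1 w.2)) := by
          refine lintegral_mono_set ?_
          rintro ⟨s, y⟩ ⟨⟨⟨hs1, -⟩, -⟩, h2⟩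
          have h3 := h2
          rw [hcyl, mem_parabolicCylinder] at h3
          exact ⟨⟨⟨hs1, h3.1.2⟩, h3.2⟩, h2⟩
  -- the right-hand side tends to `0` as `δ → 0`: the slabs `(T − 1/(n+1), T) × B` decrease to `∅`
  set μG : Measure (ℝ × EuclideanSpace ℝ (Fin 3)) :=
    (volume.restrict cyl).withDensity (fun w => ENNReal.ofReal (frobeniusNormSq (G w.1 w.2))) with hμG
  set S : ℕ → Set (ℝ × EuclideanSpace ℝ (Fin 3)) := fun n => Ioo (T - (1 / ((n : ℝ) + 1))) T ×ˢ ball x₀ R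
    with hS
  have hSm : ∀ n, MeasurableSet (S n) := fun n => measurableSet_Ioo.prod measurableSet_ball
  have hSanti : Antitone S := by
    intro m n hmn
    refine prod_mono (Ioo_subset_Ioo ?_ le_rfl) Subset.rfl
    have : (1 : ℝ) / ((n : ℝ) + 1) ≤ 1 / ((m : ℝ) + 1) :=
      one_div_le_one_div_of_le (by positivity) (by exact_mod_cast Nat.succ_le_succ hmn)
    linarith
  have hSempty : ⋂ n, S n = ∅ := by
    ext ⟨s, y⟩
    simp only [mem_iInter, mem_empty_iff_false, iff_false, not_forall]
    by_cases hs : s < T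
    · obtain ⟨n, hn⟩ := exists_nat_one_div_lt (by linarith : 0 < T - s)
      refine ⟨n, fun h => ?_⟩
      have := h.1.1
      linarith
    · exact ⟨0, fun h => hs h.1.2⟩
  have hμS : ∀ n, μG (S n) = ∫⁻ w in S n ∩ cyl, ENNReal.ofReal (frobeniusNormSq (G w.1 w.2)) := by
    intro n
    rw [hμG, withDensity_apply _ (hSm n), Measure.restrict_restrict (hSm n)]
  have hfin : μG (S 0) ≠ ∞ := by
    rw [hμS]
    exact ne_top_of_le_ne_top hGint.ne (lintegral_mono_set inter_subset_right)
  have htends : Tendsto (fun n => μG (S n)) atTop (𝓝 0) := by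
    have := tendsto_measure_iInter_atTop (μ := μG) (fun n => (hSm n).nullMeasurableSet) hSanti ⟨0, hfin⟩
    rwa [hSempty, measure_empty] at this
  -- conclusion
  have hle : ∀ n, parabolicHausdorff 1 Y ≤ 5 * (ENNReal.ofReal ε)⁻¹ * μG (S n) := by
    intro n
    have hδ : (0 : ℝ) < Real.sqrt (1 / ((n : ℝ) + 1)) := Real.sqrt_pos.2 (by positivity)
    have h1 := hest _ hδ
    rw [Real.sq_sqrt (by positivity)] at h1
    rw [hμS]
    exact h1
  have h0 : parabolicHausdorff 1 Y ≤ 0 := by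
    have hne : 5 * (ENNReal.ofReal ε)⁻¹ ≠ ∞ :=
      ENNReal.mul_ne_top (by norm_num) (ENNReal.inv_ne_top.2 (ENNReal.ofReal_pos.2 hε).ne')
    have h2 : Tendsto (fun n => 5 * (ENNReal.ofReal ε)⁻¹ * μG (S n)) atTop (𝓝 (5 * (ENNReal.ofReal ε)⁻¹ * 0)) :=
      ENNReal.Tendsto.const_mul htends (Or.inr hne)
    rw [mul_zero] at h2
    exact ge_of_tendsto' h2 hle
  exact le_antisymm h0 bot_le

end Summit.NavierStokesRegularity.NavierStokesRegularity.Theorems.AveragedConeLiouville.LidTheoremB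

end
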